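import Literature.AlgebraicGeometry.Resolution.QuadraticTransforms
import HarnessLib

/-!
# Crux `Steer` (stmt-ResolutionOfSingularities-16345 ⇒ IsolatedForcedTermination stmt-16343), chain W4.1, K-side K3-b: QUADRATIC TRANSFORMS
# AND THEIR EXCEPTIONAL PARAMETERS LIFT ALONG AN UNRAMIFIED LOCAL ENLARGEMENT OF THE WINDOW (Theses-free, definition-free)

OURS (campaign `res-hironaka`, rung L ★L-G4, slot W4.1; seat res-D-pv-040 g8 on res-L0-w41-plan-1 RULING 258 (d) / 259, custody res-plan-2;
design res-D-lib-1 `D/res-D-lib-1/K3-BLUEPRINT.md` 3e74fbc76b9dc572 item (4), consumer the K3 window package `…SteerWindowBaseChange` (route (R1),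
target `K3Target.nonRationalWindow_free`); `--supports stmt-ResolutionOfSingularities-16345 --as helper`). Replaces the role of no printed item and is
NOT a statement of the manuscript under review [claim: Hironaka2017, status: under-review]; AI-produced field/subring algebra over Cutkosky's
definition (tree `Literature…QuadraticTransforms.IsQuadraticTransform`), weaker than expert review; nothing here is progress on resolution of
singularities in characteristic `p` by itself.

## Setting (abstract, so that K3-a's étale residue enlargement `Sᵢ ↦ S′ᵢ ≅ (Sᵢ[T]/(P))_𝔫ᵢ` instantiates it by name)
Fields `K`, `K'`; a quadratic transform `R ⊂ R₁ ⊆ K` (`IsQuadraticTransform R R₁`, `R ≤ R₁`); an INJECTIVE ring map `φ : R₁ →+* K'` (no field map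
`K → K'` is assumed); local rings `R' ≤ R'₁ ⊆ K'` with `φ(R) ⊆ R'`, `φ(R₁) ⊆ R'₁`; UNRAMIFIED base: `𝔪_{R'} = φ(𝔪_R)·R'` (hypothesis `hmax`, stated
as `maximalIdeal R' = Ideal.span (range (m ↦ φ m))`); GENERATION: every `z ∈ R'₁` is `a/b` with `a, b ∈ R'[φ(R₁)]` (the subring closure) and
`b⁻¹ ∈ R'₁` (so `R'₁` is a localisation of `R'[φ(R₁)]`, as `(S_{i+1}[θ])_𝔫` is); DOMINATION `SubringDominates R' R'₁`.

## What is proved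
* `map_div_eq` — `φ(m)/φ(x) = φ(m/x)` (plumbing).
* **`isQuadraticTransform_lift`** — under the setting above, `IsQuadraticTransform R' R'₁`, with exceptional parameter `φ(x)` for the parameter
  `x` of `R ⊂ R₁`: `R'[𝔪'/φ(x)] = R'[φ(𝔪_R)/φ(x)] ⊆ R'₁` because `φ(m)/φ(x) = φ(m/x) ∈ φ(R₁)`; and every element of `R'[φ(R₁)]` is a fraction
  `a/d` with `a, d ∈ R'[𝔪'/φ(x)]`, `d ∈ R'₁ˣ` (closure induction: `φ` maps `R[𝔪/x]` into `R'[𝔪'/φ(x)]`, and the elements of `R₁` are fractions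
  over `R[𝔪/x]` with unit denominators), so the fraction clause of Cutkosky's definition holds upstairs.
* **`span_image_maximalIdeal_lift`** — the chain's `hx` binder lifts: `𝔪_R R₁ = x R₁ ⇒ 𝔪_{R'} R'₁ = φ(x) R'₁` (both generated by `φ(𝔪_R)`),
  in the literal binder shape of `K3Target.NoTangentialStepNonRationalTwo` (image of `maximalIdeal` under the inclusion `y ↦ ⟨y, _⟩`).
* `interface_hyps`, **`isQuadraticTransform_lift'`**, **`span_image_maximalIdeal_lift'`** — the same two facts in the binder shape of res-D-lib-1's
  K3 WINDOW INTERFACE (`D/res-D-lib-1/K3-window-interface.md`): ring maps INTO the subrings `φ₀ : R →+* R'`, `φ₁ : R₁ →+* R'₁` commuting with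
  the inclusions, `φ₁` injective, UNRAMIFIED as `(maximalIdeal R).map φ₀ = maximalIdeal R'`, GENERATION over `closure (φ₁(R₁) ∪ {θ})` with
  `θ ∈ R'`, DOMINANCE — conclusion `IsQuadraticTransform R' R'₁` and `Ideal.span (incl '' 𝔪_{R'}) = Ideal.span {φ₁ x}`.

[cite: Cutkosky2014, §2.1 (quadratic transforms `R → R[m_R/x]_m`)] bears_on: LADDER-RESOLUTION L ★L-G4 W4.1 (crux `Steer`, hNRW / K3 window base change).
-/

noncomputable section

set_option linter.dupNamespace false

open IsLocalRing

namespace Summit.ResolutionOfSingularities.ResolutionOfSingularities.Theorems.SwitchingDichotomy.QuadraticTransformLift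

open Literature.AlgebraicGeometry.Resolution

variable {K K' : Type} [Field K] [Field K'] {R R₁ : Subring K} {R' R'₁ : Subring K'} [IsLocalRing R] [IsLocalRing R']
  [IsLocalRing R'₁]

omit [IsLocalRing R] [IsLocalRing R'] [IsLocalRing R'₁] in
/-- The images of the quotients `m/x` (`m ∈ 𝔪_R`): `φ(m)/φ(x) = φ(m/x)`. OURS plumbing. (folklore) -/
theorem map_div_eq (hle : R ≤ R₁) (φ : R₁ →+* K') (hφ : Function.Injective φ) {x : R} (hx0 : x ≠ 0)
    {q : K} (hq : q ∈ R₁) (m : R) (hqx : q * (x : K) = (m : K)) :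
    φ ⟨(m : K), hle m.2⟩ / φ ⟨(x : K), hle x.2⟩ = φ ⟨q, hq⟩ := by
  have hx0' : φ ⟨(x : K), hle x.2⟩ ≠ 0 := by
    intro h0
    have : (⟨(x : K), hle x.2⟩ : R₁) = 0 := hφ (by rw [h0, map_zero])
    exact hx0 (Subtype.ext (by simpa using congrArg Subtype.val this))
  rw [div_eq_iff hx0', ← map_mul]
  congr 1
  exact Subtype.ext hqx.symm

/-- **K3-b (first half): a quadratic transform LIFTS along an unramified local enlargement.** Let `R ⊂ R₁ ⊆ K` be a quadratic
transform (`IsQuadraticTransform R R₁`), `φ : R₁ → K'` an injective ring map into another field, `R' ≤ R'₁ ⊆ K'` local rings with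
`φ(R) ⊆ R'`, `φ(R₁) ⊆ R'₁`, `R'₁` dominating `R'`, `𝔪_{R'} = φ(𝔪_R) R'` (UNRAMIFIED) and `R'₁` a ring of fractions `a/b`, `a, b ∈ R'[φ(R₁)]`,
`b ∈ R'₁ˣ` (e.g. `R'₁` a localisation of `R'[φ(R₁)]`). Then `R' ⊂ R'₁` is a quadratic transform (Cutkosky §2.1), with the exceptional
parameter `φ(x)`. OURS. [cite: Cutkosky2014, §2.1] -/
theorem isQuadraticTransform_lift (h : IsQuadraticTransform R R₁) (hle : R ≤ R₁) (φ : R₁ →+* K') (hφ : Function.Injective φ)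
    (hφR : ∀ y : R, φ ⟨(y : K), hle y.2⟩ ∈ R') (hφR₁ : ∀ y : R₁, φ y ∈ R'₁) (hR' : R' ≤ R'₁)
    (hmax : maximalIdeal R' = Ideal.span (Set.range fun m : maximalIdeal R => (⟨φ ⟨((m : R) : K), hle m.1.2⟩, hφR m⟩ : R')))
    (hgen : ∀ z ∈ R'₁, ∃ a ∈ Subring.closure ((R' : Set K') ∪ Set.range φ), ∃ b ∈ Subring.closure ((R' : Set K') ∪ Set.range φ),
      b⁻¹ ∈ R'₁ ∧ z = a / b)
    (hdom : SubringDominates R' R'₁) :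
    IsQuadraticTransform R' R'₁ := by
  classical
  obtain ⟨_, x, hx𝔪, hx0, _, hblow, hfrac, -⟩ := h
  have hx0K : ((x : R) : K) ≠ 0 := fun e => hx0 (Subtype.ext e)
  set x' : K' := φ ⟨(x : K), hle x.2⟩ with hx'def
  have hx'R : x' ∈ R' := hφR x
  have hx'0 : x' ≠ 0 := by
    intro h0
    have : (⟨(x : K), hle x.2⟩ : R₁) = 0 := hφ (by rw [← hx'def, h0, map_zero])
    exact hx0K (by simpa using congrArg Subtype.val this)
  have hx'𝔪 : (⟨x', hx'R⟩ : R') ∈ maximalIdeal R' := by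
    rw [hmax]; exact Ideal.subset_span ⟨⟨x, hx𝔪⟩, rfl⟩
  -- (L1) `φ(m)/x' ∈ R'₁` for `m ∈ 𝔪_R`
  have hL1 : ∀ m : R, m ∈ maximalIdeal R → φ ⟨(m : K), hle m.2⟩ / x' ∈ R'₁ := by
    intro m hm
    have hq : ((m : R) : K) / (x : K) ∈ R₁ := hblow (div_mem_blowupRing _ hm)
    rw [hx'def, map_div_eq hle φ hφ hx0 hq m (div_mul_cancel₀ _ hx0K)]
    exact hφR₁ _
  -- (blow) `R'[𝔪'/x'] ⊆ R'₁`
  have hblow' : blowupRing R' x' ≤ R'₁ := by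
    refine Subring.closure_le.mpr ?_
    rintro z (hz | ⟨y, hy, rfl⟩)
    · exact hR' hz
    · change ((y : R') : K') / x' ∈ R'₁
      have hy' : (y : R') ∈ Ideal.span (Set.range fun m : maximalIdeal R =>
          (⟨φ ⟨((m : R) : K), hle m.1.2⟩, hφR m⟩ : R')) := hmax ▸ hy
      refine Submodule.span_induction (p := fun (w : R') _ => ((w : R') : K') / x' ∈ R'₁) ?_ ?_ ?_ ?_ hy'
      · rintro _ ⟨m, rfl⟩
        exact hL1 m m.2
      · simp only [ZeroMemClass.coe_zero, zero_div]; exact R'₁.zero_mem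
      · intro a b _ _ ha hb
        rw [Subring.coe_add, add_div]; exact R'₁.add_mem ha hb
      · intro c a _ ha
        rw [smul_eq_mul, Subring.coe_mul, mul_div_assoc]; exact R'₁.mul_mem (hR' c.2) ha
  -- (L3) `φ` maps `R[𝔪/x]` into `B' := R'[𝔪'/x']`
  have hL3 : ∀ q ∈ blowupRing R ((x : R) : K), ∃ hq : q ∈ R₁, φ ⟨q, hq⟩ ∈ blowupRing R' x' := by
    intro q hq
    refine Subring.closure_induction (p := fun q _ => ∃ hq : q ∈ R₁, φ ⟨q, hq⟩ ∈ blowupRing R' x') ?_ ?_ ?_ ?_ ?_ ?_ hq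
    · rintro z (hz | ⟨m, hm, rfl⟩)
      · exact ⟨hle hz, le_blowupRing R' x' (hφR ⟨z, hz⟩)⟩
      · refine ⟨hblow (div_mem_blowupRing _ hm), ?_⟩
        rw [← map_div_eq hle φ hφ hx0 (hblow (div_mem_blowupRing _ hm)) m (div_mul_cancel₀ _ hx0K), ← hx'def]
        have hm' : (⟨φ ⟨((m : R) : K), hle m.2⟩, hφR m⟩ : R') ∈ maximalIdeal R' := by
          rw [hmax]; exact Ideal.subset_span ⟨⟨m, hm⟩, rfl⟩
        exact div_mem_blowupRing x' hm'
    · exact ⟨R₁.zero_mem, by rw [show (⟨(0 : K), R₁.zero_mem⟩ : R₁) = 0 from rfl, map_zero]; exact Subring.zero_mem _⟩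
    · exact ⟨R₁.one_mem, by rw [show (⟨(1 : K), R₁.one_mem⟩ : R₁) = 1 from rfl, map_one]; exact Subring.one_mem _⟩
    · rintro a b _ _ ⟨ha, ha'⟩ ⟨hb, hb'⟩
      refine ⟨R₁.add_mem ha hb, ?_⟩
      rw [show (⟨a + b, R₁.add_mem ha hb⟩ : R₁) = ⟨a, ha⟩ + ⟨b, hb⟩ from rfl, map_add]
      exact Subring.add_mem _ ha' hb'
    · rintro a _ ⟨ha, ha'⟩
      refine ⟨R₁.neg_mem ha, ?_⟩
      rw [show (⟨-a, R₁.neg_mem ha⟩ : R₁) = -⟨a, ha⟩ from rfl, map_neg]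
      exact Subring.neg_mem _ ha'
    · rintro a b _ _ ⟨ha, ha'⟩ ⟨hb, hb'⟩
      refine ⟨R₁.mul_mem ha hb, ?_⟩
      rw [show (⟨a * b, R₁.mul_mem ha hb⟩ : R₁) = ⟨a, ha⟩ * ⟨b, hb⟩ from rfl, map_mul]
      exact Subring.mul_mem _ ha' hb'
  -- (L2) every element of `R'[φ(R₁)]` is a fraction `a/d`, `a, d ∈ B'`, `d ≠ 0`, `d⁻¹ ∈ R'₁`
  have hL2 : ∀ c ∈ Subring.closure ((R' : Set K') ∪ Set.range φ),
      ∃ a ∈ blowupRing R' x', ∃ d ∈ blowupRing R' x', d ≠ 0 ∧ d⁻¹ ∈ R'₁ ∧ c = a / d := by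
    intro c hc
    refine Subring.closure_induction (p := fun c _ =>
      ∃ a ∈ blowupRing R' x', ∃ d ∈ blowupRing R' x', d ≠ 0 ∧ d⁻¹ ∈ R'₁ ∧ c = a / d) ?_ ?_ ?_ ?_ ?_ ?_ hc
    · rintro z (hz | ⟨y, rfl⟩)
      · exact ⟨z, le_blowupRing R' x' hz, 1, Subring.one_mem _, one_ne_zero, by rw [inv_one]; exact R'₁.one_mem,
          by rw [div_one]⟩
      · -- `y = a/b` with `a, b ∈ R[𝔪/x]`, `b⁻¹ ∈ R₁`
        obtain ⟨a, ha, b, hb, hbinv, hyab⟩ := hfrac (y : K) y.2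
        by_cases hb0 : b = 0
        · refine ⟨0, Subring.zero_mem _, 1, Subring.one_mem _, one_ne_zero, by rw [inv_one]; exact R'₁.one_mem, ?_⟩
          have hy0 : y = 0 := Subtype.ext (by rw [hyab, hb0, div_zero]; rfl)
          rw [hy0, map_zero, zero_div]
        obtain ⟨haR₁, ha'⟩ := hL3 a ha
        obtain ⟨hbR₁, hb'⟩ := hL3 b hb
        have hφb0 : φ ⟨b, hbR₁⟩ ≠ 0 := by
          intro h0
          have : (⟨b, hbR₁⟩ : R₁) = 0 := hφ (by rw [h0, map_zero])
          exact hb0 (by simpa using congrArg Subtype.val this)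
        refine ⟨φ ⟨a, haR₁⟩, ha', φ ⟨b, hbR₁⟩, hb', hφb0, ?_, ?_⟩
        · -- `(φ b)⁻¹ = φ (b⁻¹) ∈ R'₁`
          have hbb : (⟨b, hbR₁⟩ : R₁) * ⟨b⁻¹, hbinv⟩ = 1 := Subtype.ext (mul_inv_cancel₀ hb0)
          have : φ ⟨b, hbR₁⟩ * φ ⟨b⁻¹, hbinv⟩ = 1 := by rw [← map_mul, hbb, map_one]
          rw [show (φ ⟨b, hbR₁⟩)⁻¹ = φ ⟨b⁻¹, hbinv⟩ from (eq_inv_of_mul_eq_one_right this).symm]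
          exact hφR₁ _
        · rw [eq_div_iff hφb0, ← map_mul]
          congr 1
          exact Subtype.ext (by change (y : K) * b = a; rw [hyab]; exact div_mul_cancel₀ a hb0)
    · exact ⟨0, Subring.zero_mem _, 1, Subring.one_mem _, one_ne_zero, by rw [inv_one]; exact R'₁.one_mem, by rw [zero_div]⟩
    · exact ⟨1, Subring.one_mem _, 1, Subring.one_mem _, one_ne_zero, by rw [inv_one]; exact R'₁.one_mem, by rw [div_one]⟩
    · rintro c₁ c₂ _ _ ⟨a₁, ha₁, d₁, hd₁, hd₁0, hd₁i, rfl⟩ ⟨a₂, ha₂, d₂, hd₂, hd₂0, hd₂i, rfl⟩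
      refine ⟨a₁ * d₂ + a₂ * d₁, Subring.add_mem _ (Subring.mul_mem _ ha₁ hd₂) (Subring.mul_mem _ ha₂ hd₁), d₁ * d₂,
        Subring.mul_mem _ hd₁ hd₂, mul_ne_zero hd₁0 hd₂0, ?_, ?_⟩
      · rw [mul_inv]; exact R'₁.mul_mem hd₁i hd₂i
      · field_simp
    · rintro c _ ⟨a, ha, d, hd, hd0, hdi, rfl⟩
      exact ⟨-a, Subring.neg_mem _ ha, d, hd, hd0, hdi, by rw [neg_div]⟩
    · rintro c₁ c₂ _ _ ⟨a₁, ha₁, d₁, hd₁, hd₁0, hd₁i, rfl⟩ ⟨a₂, ha₂, d₂, hd₂, hd₂0, hd₂i, rfl⟩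
      refine ⟨a₁ * a₂, Subring.mul_mem _ ha₁ ha₂, d₁ * d₂, Subring.mul_mem _ hd₁ hd₂, mul_ne_zero hd₁0 hd₂0, ?_, ?_⟩
      · rw [mul_inv]; exact R'₁.mul_mem hd₁i hd₂i
      · rw [div_mul_div_comm]
  refine ⟨inferInstance, ⟨x', hx'R⟩, hx'𝔪, fun e => hx'0 (congrArg Subtype.val e), inferInstance, hblow', ?_, hdom⟩
  -- (frac) every `z ∈ R'₁` is `a/b` with `a, b ∈ B'`, `b⁻¹ ∈ R'₁`
  intro z hz
  obtain ⟨a, ha, b, hb, hbinv, rfl⟩ := hgen z hz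
  by_cases hb0 : b = 0
  · exact ⟨0, Subring.zero_mem _, 1, Subring.one_mem _, by rw [inv_one]; exact R'₁.one_mem, by rw [hb0, div_zero, zero_div]⟩
  obtain ⟨a₁, ha₁, d₁, hd₁, hd₁0, hd₁i, rfl⟩ := hL2 a ha
  obtain ⟨a₂, ha₂, d₂, hd₂, hd₂0, hd₂i, rfl⟩ := hL2 b hb
  have ha₂0 : a₂ ≠ 0 := by rintro rfl; exact hb0 (zero_div _)
  refine ⟨a₁ * d₂, Subring.mul_mem _ ha₁ hd₂, a₂ * d₁, Subring.mul_mem _ ha₂ hd₁, ?_, ?_⟩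
  · -- `(a₂ d₁)⁻¹ = (a₂/d₂)⁻¹ · d₂⁻¹ · d₁⁻¹`
    have : (a₂ * d₁)⁻¹ = (a₂ / d₂)⁻¹ * d₂⁻¹ * d₁⁻¹ := by field_simp
    rw [this]
    exact R'₁.mul_mem (R'₁.mul_mem hbinv hd₂i) hd₁i
  · field_simp

omit [IsLocalRing R'₁] in
/-- **K3-b (second half): the exceptional parameter generates upstairs** (`hx′` from `hx`). With `φ(R) ⊆ R' ≤ R'₁ ⊇ φ(R₁)` and
`𝔪_{R'} = φ(𝔪_R)R'` (unramified): if `𝔪_R R₁ = x R₁` then `𝔪_{R'} R'₁ = φ(x) R'₁` — both sides are generated by the images of `𝔪_R`.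
Stated with the chain's literal `hx` binder shape (`K3Target.NoTangentialStepNonRationalTwo`). OURS. (folklore) -/
theorem span_image_maximalIdeal_lift (hle : R ≤ R₁) (φ : R₁ →+* K')
    (hφR : ∀ y : R, φ ⟨(y : K), hle y.2⟩ ∈ R') (hφR₁ : ∀ y : R₁, φ y ∈ R'₁) (hR' : R' ≤ R'₁)
    (hmax : maximalIdeal R' = Ideal.span (Set.range fun m : maximalIdeal R => (⟨φ ⟨((m : R) : K), hle m.1.2⟩, hφR m⟩ : R')))
    (x : R₁) (hx : Ideal.span ((fun y : R => (⟨(y : K), hle y.2⟩ : R₁)) '' (maximalIdeal R : Set R)) = Ideal.span {x}) :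
    Ideal.span ((fun y : R' => (⟨(y : K'), hR' y.2⟩ : R'₁)) '' (maximalIdeal R' : Set R')) =
      Ideal.span {(⟨φ x, hφR₁ x⟩ : R'₁)} := by
  classical
  -- the ring maps `ψ : R₁ → R'₁` (= `φ`) and the inclusions
  let ψ : R₁ →+* R'₁ := φ.codRestrict R'₁ hφR₁
  have hψ : ∀ y : R₁, (ψ y : K') = φ y := fun _ => rfl
  let ι' : R' →+* R'₁ := Subring.inclusion hR'
  apply le_antisymm
  · -- `⊆`: each generator `m' ∈ 𝔪_{R'}` maps into `φ(x) R'₁`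
    rw [Ideal.span_le]
    rintro _ ⟨m', hm', rfl⟩
    change ι' m' ∈ Ideal.span {(⟨φ x, hφR₁ x⟩ : R'₁)}
    have hm'' : (m' : R') ∈ Ideal.span (Set.range fun m : maximalIdeal R =>
        (⟨φ ⟨((m : R) : K), hle m.1.2⟩, hφR m⟩ : R')) := hmax ▸ hm'
    refine Submodule.span_induction (p := fun (w : R') _ => ι' w ∈ Ideal.span {(⟨φ x, hφR₁ x⟩ : R'₁)}) ?_ ?_ ?_ ?_ hm''
    · rintro _ ⟨m, rfl⟩
      -- `incl m ∈ x R₁`, so `φ(m) = φ(r) φ(x)`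
      have hmx : (⟨((m : R) : K), hle m.1.2⟩ : R₁) ∈ Ideal.span {x} := hx ▸ Ideal.subset_span ⟨m, m.2, rfl⟩
      obtain ⟨r, hr⟩ := Ideal.mem_span_singleton'.mp hmx
      have : ι' ⟨φ ⟨((m : R) : K), hle m.1.2⟩, hφR m⟩ = ψ r * ⟨φ x, hφR₁ x⟩ := by
        apply Subtype.ext
        change φ ⟨((m : R) : K), hle m.1.2⟩ = φ r * φ x
        rw [← map_mul, hr]
      rw [this]
      exact Ideal.mul_mem_left _ _ (Ideal.mem_span_singleton_self _)
    · rw [map_zero]; exact Ideal.zero_mem _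
    · intro a b _ _ ha hb; rw [map_add]; exact Ideal.add_mem _ ha hb
    · intro c a _ ha; rw [smul_eq_mul, map_mul]; exact Ideal.mul_mem_left _ _ ha
  · -- `⊇`: `x ∈ 𝔪_R R₁`, so `φ(x)` lies in the ideal generated by `φ(𝔪_R) ⊆ 𝔪_{R'}`
    rw [Ideal.span_singleton_le_iff_mem]
    have hxm : x ∈ Ideal.span ((fun y : R => (⟨(y : K), hle y.2⟩ : R₁)) '' (maximalIdeal R : Set R)) :=
      hx ▸ Ideal.mem_span_singleton_self x
    have key : ∀ v ∈ Ideal.span ((fun y : R => (⟨(y : K), hle y.2⟩ : R₁)) '' (maximalIdeal R : Set R)),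
        ψ v ∈ Ideal.span ((fun y : R' => (⟨(y : K'), hR' y.2⟩ : R'₁)) '' (maximalIdeal R' : Set R')) := by
      intro v hv
      refine Submodule.span_induction (p := fun (v : R₁) _ =>
        ψ v ∈ Ideal.span ((fun y : R' => (⟨(y : K'), hR' y.2⟩ : R'₁)) '' (maximalIdeal R' : Set R'))) ?_ ?_ ?_ ?_ hv
      · rintro _ ⟨m, hm, rfl⟩
        have hm' : (⟨φ ⟨((m : R) : K), hle m.2⟩, hφR m⟩ : R') ∈ maximalIdeal R' := by
          rw [hmax]; exact Ideal.subset_span ⟨⟨m, hm⟩, rfl⟩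
        have : ψ ⟨((m : R) : K), hle m.2⟩ = (⟨(((⟨φ ⟨((m : R) : K), hle m.2⟩, hφR m⟩ : R') : R') : K'),
            hR' (hφR m)⟩ : R'₁) := Subtype.ext rfl
        rw [this]
        exact Ideal.subset_span ⟨_, hm', rfl⟩
      · rw [map_zero]; exact Ideal.zero_mem _
      · intro a b _ _ ha hb; rw [map_add]; exact Ideal.add_mem _ ha hb
      · intro c a _ ha; rw [smul_eq_mul, map_mul]; exact Ideal.mul_mem_left _ _ ha
    have hψx : ψ x = ⟨φ x, hφR₁ x⟩ := Subtype.ext rfl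
    rw [← hψx]
    exact key x hxm

/-! ### The same two facts in the binder shape of res-D-lib-1's K3 WINDOW INTERFACE (`D/res-D-lib-1/K3-window-interface.md`):
ring maps INTO the subrings `φ₀ : R →+* R'`, `φ₁ : R₁ →+* R'₁` commuting with the inclusions, UNRAMIFIED as `(𝔪_R).map φ₀ = 𝔪_{R'}`,
GENERATION over `closure (φ₁(R₁) ∪ {θ})` with `θ ∈ R'`. -/

omit [IsLocalRing R'₁] in
/-- Interface plumbing: the hypotheses of the K3 window interface imply the abstract ones above. OURS. (folklore) -/
theorem interface_hyps (hle : R ≤ R₁) (φ₀ : R →+* R') (φ₁ : R₁ →+* R'₁)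
    (hcomm : ∀ s : R, ((φ₁ (Subring.inclusion hle s) : R'₁) : K') = ((φ₀ s : R') : K'))
    (hunr : (maximalIdeal R).map φ₀ = maximalIdeal R') :
    (∀ y : R, (R'₁.subtype.comp φ₁) ⟨(y : K), hle y.2⟩ ∈ R') ∧
    ∀ hφR : ∀ y : R, (R'₁.subtype.comp φ₁) ⟨(y : K), hle y.2⟩ ∈ R',
      maximalIdeal R' = Ideal.span (Set.range fun m : maximalIdeal R =>
        (⟨(R'₁.subtype.comp φ₁) ⟨((m : R) : K), hle m.1.2⟩, hφR m⟩ : R')) := by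
  have hφR : ∀ y : R, (R'₁.subtype.comp φ₁) ⟨(y : K), hle y.2⟩ ∈ R' := fun y => by
    change ((φ₁ (Subring.inclusion hle y) : R'₁) : K') ∈ R'
    rw [hcomm]; exact (φ₀ y).2
  refine ⟨hφR, fun hφR' => ?_⟩
  have hfun : (Set.range fun m : maximalIdeal R => (⟨(R'₁.subtype.comp φ₁) ⟨((m : R) : K), hle m.1.2⟩, hφR' m⟩ : R')) =
      φ₀ '' (maximalIdeal R : Set R) := by
    ext w
    constructor
    · rintro ⟨m, rfl⟩
      refine ⟨m, m.2, Subtype.ext ?_⟩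
      change ((φ₀ m : R') : K') = ((φ₁ (Subring.inclusion hle m) : R'₁) : K')
      rw [hcomm]
    · rintro ⟨m, hm, rfl⟩
      refine ⟨⟨m, hm⟩, Subtype.ext ?_⟩
      change ((φ₁ (Subring.inclusion hle m) : R'₁) : K') = ((φ₀ m : R') : K')
      rw [hcomm]
  rw [hfun, ← hunr, Ideal.map, Ideal.span]

/-- **K3-b in the window-interface shape: `IsQuadraticTransform S′ᵢ S′ᵢ₊₁`.** OURS. [cite: Cutkosky2014, §2.1] -/
theorem isQuadraticTransform_lift' (h : IsQuadraticTransform R R₁) (hle : R ≤ R₁) (hle' : R' ≤ R'₁)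
    (φ₀ : R →+* R') (φ₁ : R₁ →+* R'₁) (hinj : Function.Injective φ₁)
    (hcomm : ∀ s : R, ((φ₁ (Subring.inclusion hle s) : R'₁) : K') = ((φ₀ s : R') : K'))
    (hunr : (maximalIdeal R).map φ₀ = maximalIdeal R') {θ : K'} (hθ : θ ∈ R')
    (hgen : ∀ z ∈ R'₁, ∃ u ∈ Subring.closure (Set.range (fun s : R₁ => ((φ₁ s : R'₁) : K')) ∪ {θ}),
      ∃ v ∈ Subring.closure (Set.range (fun s : R₁ => ((φ₁ s : R'₁) : K')) ∪ {θ}), v⁻¹ ∈ R'₁ ∧ z = u / v)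
    (hdom : SubringDominates R' R'₁) : IsQuadraticTransform R' R'₁ := by
  obtain ⟨hφR, hmax⟩ := interface_hyps (R'₁ := R'₁) hle φ₀ φ₁ hcomm hunr
  have hsub : Subring.closure (Set.range (fun s : R₁ => ((φ₁ s : R'₁) : K')) ∪ {θ}) ≤
      Subring.closure ((R' : Set K') ∪ Set.range (R'₁.subtype.comp φ₁)) := by
    refine Subring.closure_mono ?_
    rintro z (⟨s, rfl⟩ | hz)
    · exact Or.inr ⟨s, rfl⟩
    · rw [Set.mem_singleton_iff] at hz; subst hz; exact Or.inl hθ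
  refine isQuadraticTransform_lift h hle (R'₁.subtype.comp φ₁) (Subtype.val_injective.comp hinj) hφR
    (fun y => (φ₁ y).2) hle' (hmax hφR) (fun z hz => ?_) hdom
  obtain ⟨u, hu, v, hv, hvi, hz⟩ := hgen z hz
  exact ⟨u, hsub hu, v, hsub hv, hvi, hz⟩

omit [IsLocalRing R'₁] in
/-- **K3-b in the window-interface shape: the `hx′` binder.** OURS. (folklore) -/
theorem span_image_maximalIdeal_lift' (hle : R ≤ R₁) (hle' : R' ≤ R'₁) (φ₀ : R →+* R') (φ₁ : R₁ →+* R'₁)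
    (hcomm : ∀ s : R, ((φ₁ (Subring.inclusion hle s) : R'₁) : K') = ((φ₀ s : R') : K'))
    (hunr : (maximalIdeal R).map φ₀ = maximalIdeal R') (x : R₁)
    (hx : Ideal.span ((fun y : R => (⟨(y : K), hle y.2⟩ : R₁)) '' (maximalIdeal R : Set R)) = Ideal.span {x}) :
    Ideal.span ((fun y : R' => (⟨(y : K'), hle' y.2⟩ : R'₁)) '' (maximalIdeal R' : Set R')) = Ideal.span {φ₁ x} := by
  obtain ⟨hφR, hmax⟩ := interface_hyps (R'₁ := R'₁) hle φ₀ φ₁ hcomm hunr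
  have h := span_image_maximalIdeal_lift hle (R'₁.subtype.comp φ₁) hφR (fun y => (φ₁ y).2) hle' (hmax hφR) x hx
  rw [h]
  exact congrArg (fun t : R'₁ => Ideal.span {t}) (Subtype.ext rfl)

end Summit.ResolutionOfSingularities.ResolutionOfSingularities.Theorems.SwitchingDichotomy.QuadraticTransformLift

end
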